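import Summits.BirchSwinnertonDyer.BirchSwinnertonDyer.Theorems.ByReductionTypeAtTwoAdditivePotGoodLowerHalfT0ClassLiftA
import Summits.BirchSwinnertonDyer.BirchSwinnertonDyer.Theorems.ByReductionTypeAtTwoAdditivePotGoodLowerHalfT0ClassLiftE
import Summits.BirchSwinnertonDyer.BirchSwinnertonDyer.Theorems.ByReductionTypeAtTwoFineSelmerConjAAtTwoAdditivePotGoodFukudaRowStampsF
import Summits.BirchSwinnertonDyer.BirchSwinnertonDyer.Theorems.ByReductionTypeAtTwoOrdKatoHalfAtTwoIsoConjATwoCubicModelOfClassicalMu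
import Literature.NumberTheory.IwasawaTheory.Fukuda1994Thm1RankProofs
import HarnessLib

/-!
# K4 crux `AdditiveRankZeroAtTwo` (19098), child C3″ `AdditivePotGoodLowerHalfAtTwo` (item 22617): the `Δ_cubic < 0` OPEN-TYPE rows of the C1″ census —
# statement (A) at `2` and the BSD₂ rungs WITHOUT ANY PRINT FACT for (A), modulo ONE displayed two-conjunct TOWER CERTIFICATE on the cubic point field
# (file A of the `TowerCertRows` series A–D; seat `bsd-2adic-k4-w2` GEN 10; `--supports stmt-BirchSwinnertonDyer-22617 --as helper`)

Cell `bsd-2adic`. These rows (`245980i1`, `112520h1`) had NO (A)₂ stamp in k4-w1 GEN 8's census («open type»: the `2`-ranks of the class groups of the cubic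
point field `ℚ(θ)` do not stabilise between layers `0` and `1` of the cyclotomic `ℤ₂`-tower, so the two-layer / capitulation doors are void; their only
C3″ rung was GEN 3's `bsdp_two_<L>_of_fukudaCertificate_pointField hLim2 hFuk hcert` on the carrier `ℚ(P, √−1)`). The instrument census
(`addL2x/gen8/conjA3_census_j300990_classes.tsv`, `conjA4_full_j301920_classes.tsv`; PARI, GRH at degree ≥ 12) shows rank stabilisation ONE layer up
(layers `1 → 2`; `2 → 3` for `288648g1`; `306680s1` has `n₀ = 1`). Since cruxlead-19573-w2 GEN 7's KERNEL `ℓ = 2` ascent (p728213) needs only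
`μ₂(ℚ(θ)_cyc) = 0` on `Δ_cubic < 0` rows and Fukuda 1994 Thm. 1 (2) is a tree theorem (`_holds`), §1 gives per row
`AddKatoTwo.conjA_two_<L>_of_towerCert hθ hcert` — (A)₂ with NO print fact, displaying ONLY the two-conjunct certificate
`hcert : ∀ κL cyclotomic, TotallyRamifiedFrom κL n₀ ∧ rank₂ Cl(layer n+1) = rank₂ Cl(layer n)` on the CUBIC tower `ℚ(θ) ⊂ ℚ(θ)·ℚ₁ ⊂ …` (degrees `3·2ⁿ`;
cheaper than GEN 3's sextic tower `ℚ(P, i)`); §0 is the generic door `conjA_two_cubicModel_of_towerCert_of_discr_neg` (file A; the row proofs inline it so files B–D need not import A while its olean is unbuilt); §2 re-keys GEN 3's rungs: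
`AddPotGoodInstances.bsdp_two_<L>_towerCert`, `bsdp_two_of_isIsogenous_<L>_towerCert` — BSD₂ on the class ⟸ PRINT {hSharp (reading), hGZK, hmod, hCT(, hCassels)}
+ RECORD {r_an = 0, #Ш_an = q, ord₂ q ≤ 6} + the two VALUED Selmer slots + `hcert`. Model changes `θ ↔ β = x(P)` are exact (reduced cubics found and verified by
exact rational arithmetic, `tools/rowcalc.py` of the seat folder).

HONEST FRAMING (D-0036 / D-0054 / D-0152): conditional theorems; `hcert` is an INSTRUMENT-tier numeric input (PARI class groups of number fields of degree
`3·2ⁿ ≤ 24`, GRH-conditional above degree 6 in the kit runs) — NOT certified in the kernel and NOT a fact from print; `hSharp` is the Kato-at-`2` SHARP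
reading (D-audit PASS). Closes nothing at the `∀`-level (C3″ 22617 / C1″ 22615 OPEN); nothing booked (D-0054); no rung moves; BSD is not proved by
any of this. THEOREMS ONLY (no `def`). The two remaining open-type rows are `412400n1` (ranks jump at every computed layer — no certificate) and
`174920h1` (`Δ_cubic > 0` — no ascent).

References: [Fukuda1994] Thm. 1 (2), p. 264; [Iwasawa1973MuInvariants] Thm. 2/3; [CoatesSujatha2005] (A), Thm. 3.4; [Washington1997] §13.1 Lemma 13.3;
[Kato2004Asterisque] Thm. 12.5 (1)(3), 13.8, 14.14; [Cassels1965ArithmeticVIII] Thm. 1.3; [Miller2011LMS] Def. 1.1.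
-/

set_option autoImplicit false
-- the Theorems namespace of this sub repeats the summit name by design (D-0017 nested layout)
set_option linter.dupNamespace false

noncomputable section

open scoped Classical IntermediateField NumberField Real nonZeroDivisors

/-! ## §0–§1 The door and the stamps (namespace `AddKatoTwo`) -/

namespace Summit.BirchSwinnertonDyer.BirchSwinnertonDyer.Theorems.AddKatoTwo

open WeierstrassCurve Field Polynomial IsDedekindDomain NumberField Matrix Literature.NumberTheory.EllipticCurves
  Literature.NumberTheory.GaloisRepresentations
  Literature.NumberTheory.IwasawaTheory
  Summit.BirchSwinnertonDyer.BirchSwinnertonDyer.Theorems.SteinbergFibreAtTwo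
  Summit.BirchSwinnertonDyer.BirchSwinnertonDyer.Theorems.AlignedTransportAtTwoTorsionPointField
  Summit.BirchSwinnertonDyer.BirchSwinnertonDyer.Theses.ByReductionTypeAtTwo

/-- **A monic integer cubic with a root `β` of degree `3` is irreducible** (restated to keep this file off `…AscentStampsA`). [folklore] -/
private theorem irreducibleCubic_of_finrank_three_tcA {p q r : ℤ} {β : AlgebraicClosure ℚ}
    (hβ : aeval β (Cubic.toPoly ⟨1, (p : ℚ), q, r⟩) = 0) (h3 : Module.finrank ℚ (IntermediateField.adjoin ℚ {β}) = 3) :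
    Irreducible (Cubic.toPoly ⟨1, (p : ℚ), q, r⟩) := by
  have hfm : (Cubic.toPoly ⟨1, (p : ℚ), q, r⟩).Monic := Cubic.monic_of_a_eq_one'
  have hβint : IsIntegral ℚ β := ⟨_, hfm, by rwa [← aeval_def]⟩
  have hdeg : (minpoly ℚ β).natDegree = (Cubic.toPoly ⟨1, (p : ℚ), q, r⟩).natDegree := by
    rw [← IntermediateField.adjoin.finrank hβint, h3, Cubic.natDegree_of_a_ne_zero' one_ne_zero]
  have heq : Cubic.toPoly ⟨1, (p : ℚ), q, r⟩ = minpoly ℚ β :=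
    Polynomial.eq_of_monic_of_dvd_of_natDegree_le (minpoly.monic hβint) hfm (minpoly.dvd ℚ β hβ) hdeg.ge
  rw [heq]
  exact minpoly.irreducible hβint

/-- **THE TOWER-CERTIFICATE DOOR on the cubic model (Δ_cubic < 0), KERNEL**: `y² = X³ + pX² + qX + r` with irreducible cubic of NEGATIVE discriminant,
`β` a root; if every cyclotomic `ℤ₂`-extension of the cubic point field `ℚ(β)` is totally ramified from layer `n₀` and has equal `2`-ranks of the class
groups at layers `n`, `n + 1` for some `n ≥ n₀` (the displayed two-conjunct certificate), then statement (A) holds at `2` (`∃ γ D` form) for every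
cyclotomic `κ` over `ℚ`: Fukuda 1994 Thm. 1 (2) (`classicalMuVanishes_of_classGroupPRank_succ_eq'`, tree `_holds`) gives `μ₂(ℚ(β)_cyc) = 0`, and
cruxlead-19573-w2's `ℓ = 2` ascent door `TotallyComplexMu.conjA_two_cubicModel_of_classicalMu_of_discr_neg` (p728213) concludes. No print fact.
[cite: Fukuda1994, Thm. 1 (2), p. 264] [cite: Iwasawa1973MuInvariants, Thm. 2 and Thm. 3] [cite: CoatesSujatha2005, Conj. A and Thm. 3.4] -/
theorem conjA_two_cubicModel_of_towerCert_of_discr_neg (p q r : ℤ)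
    [((⟨0, (p : ℚ), 0, (q : ℚ), (r : ℚ)⟩ : WeierstrassCurve ℚ)).IsElliptic]
    (hirr : Irreducible (Cubic.toPoly ⟨1, (p : ℚ), q, r⟩)) (hd : Cubic.discr ⟨1, (p : ℚ), q, r⟩ < 0)
    {β : AlgebraicClosure ℚ} (hβ : aeval β (Cubic.toPoly ⟨1, (p : ℚ), q, r⟩) = 0)
    (n₀ n : ℕ) (hn : n₀ ≤ n)
    (hcert : haveI : FiniteDimensional ℚ (IntermediateField.adjoin ℚ ({β} : Set (AlgebraicClosure ℚ))) :=
        IntermediateField.adjoin.finiteDimensional ((AlgebraicClosure.isAlgebraic ℚ).isAlgebraic β).isIntegral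
      haveI : NumberField (IntermediateField.adjoin ℚ ({β} : Set (AlgebraicClosure ℚ))) := NumberField.mk
      ∀ κP : ZpExtension ↥(IntermediateField.adjoin ℚ ({β} : Set (AlgebraicClosure ℚ))) 2,
        κP.IsCyclotomic → TotallyRamifiedFrom κP n₀ ∧ classGroupPRank κP (n + 1) = classGroupPRank κP n)
    (κ : ZpExtension ℚ 2) (hκ : κ.IsCyclotomic) :
    ∃ (γ : absoluteGaloisGroup ℚ) (D : ((⟨0, (p : ℚ), 0, (q : ℚ), (r : ℚ)⟩ : WeierstrassCurve ℚ)).FineSelmerDualData κ γ),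
      Module.Finite ℤ_[2] (RestrictScalars ℤ_[2] (IwasawaAlgebra 2) D.X) := by
  haveI : Fact (Nat.Prime 2) := ⟨Nat.prime_two⟩
  haveI : FiniteDimensional ℚ (IntermediateField.adjoin ℚ ({β} : Set (AlgebraicClosure ℚ))) :=
    IntermediateField.adjoin.finiteDimensional ((AlgebraicClosure.isAlgebraic ℚ).isAlgebraic β).isIntegral
  haveI : NumberField (IntermediateField.adjoin ℚ ({β} : Set (AlgebraicClosure ℚ))) := NumberField.mk
  exact TotallyComplexMu.conjA_two_cubicModel_of_classicalMu_of_discr_neg p q r hirr hd hβ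
    (fun κP hκP => classicalMuVanishes_of_classGroupPRank_succ_eq' κP (hcert κP hκP).1 hn (hcert κP hκP).2) κ hκ

/-- `X³ + (-1)X² + (-9)X + (-41)` (a reduced model of the `2`-torsion cubic field of `245980i1`, discriminant `-49196`) is irreducible over `ℚ`
(no root mod `3`). -/
theorem irreducible_cubic_h245980i1 : Irreducible (Cubic.toPoly ⟨1, ((-1 : ℤ) : ℚ), ((-9 : ℤ) : ℚ), ((-41 : ℤ) : ℚ)⟩) :=
  haveI : Fact (Nat.Prime 3) := ⟨by norm_num⟩
  irreducible_cubic_of_no_root_zmod 3 (by decide)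

/-- **(A)₂ for `245980i1` WITHOUT any print fact — ONE displayed two-conjunct TOWER CERTIFICATE on the cubic point field** (open-type row of the
C1″ census: `d = −49196`, `2 = 𝔭³`, `Cl(ℚ(θ)) = [6]`; tower ranks 1 / 2 / 2 (layers 0/1/2, PARI `cyc = [6], [6,2], [6,2]`)). `θ` is any root of `X³ + (-1)X² + (-9)X + (-41)` (`ℚ(P) = ℚ(β) = ℚ(θ)`, `β = x(P) = -693 + (350)θ + (91)θ²`
a root of the `2`-division cubic); displayed: along every cyclotomic `ℤ₂`-extension of `ℚ(θ)`, total ramification from layer `0` AND equal `2`-ranks of the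
class groups at layers `1`, `1 + 1` (instrument tier: PARI `bnfinit`, GRH at degree ≥ 12; cell TSV `addL2x/gen8/conjA3_census_j300990_classes.tsv`).
KERNEL: Fukuda 1994 Thm. 1 (2) (`classicalMuVanishes_of_classGroupPRank_succ_eq'`, tree `_holds`) ⟹ `μ₂(ℚ(θ)_cyc) = 0` ⟹ cruxlead-19573-w2's `ℓ = 2` ascent
to the totally complex `ℚ(E[2])` (`Δ_cubic < 0`) and guarded kernel Lim 3.5@2 (`TotallyComplexMu.conjA_two_cubicModel_of_classicalMu_of_discr_neg`, p728213).
No `hLim2`, no Fukuda fact, no class-number bit. BSD for `245980i1` is NOT proved by this. [cite: CoatesSujatha2005, Conj. A and Thm. 3.4]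
[cite: Fukuda1994, Thm. 1 (2), p. 264] [cite: Iwasawa1973MuInvariants, Thm. 2 and Thm. 3] [cite: Washington1997, §13.1 Lemma 13.3] -/
theorem conjA_two_245980i1_of_towerCert
    {θ : AlgebraicClosure ℚ} (hθ : aeval θ (Cubic.toPoly ⟨1, ((-1 : ℤ) : ℚ), ((-9 : ℤ) : ℚ), ((-41 : ℤ) : ℚ)⟩) = 0)
    (hcert : haveI : FiniteDimensional ℚ (IntermediateField.adjoin ℚ {θ}) :=
        IntermediateField.adjoin.finiteDimensional ((AlgebraicClosure.isAlgebraic ℚ).isAlgebraic θ).isIntegral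
      haveI : NumberField (IntermediateField.adjoin ℚ {θ}) := NumberField.mk
      ∀ κL : ZpExtension (IntermediateField.adjoin ℚ {θ}) 2, κL.IsCyclotomic →
        TotallyRamifiedFrom κL 0 ∧ classGroupPRank κL (1 + 1) = classGroupPRank κL 1)
    (κ : ZpExtension ℚ 2) (hκ : κ.IsCyclotomic) :
    haveI := (isElliptic_cubicModel _ _ _ (by simp only [Cubic.discr]; norm_num) : (⟨0, ((0 : ℤ) : ℚ), 0, ((-6755728 : ℤ) : ℚ), ((-6761091148 : ℤ) : ℚ)⟩ : WeierstrassCurve ℚ).IsElliptic)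
    ∃ (γ : absoluteGaloisGroup ℚ) (D : (⟨0, ((0 : ℤ) : ℚ), 0, ((-6755728 : ℤ) : ℚ), ((-6761091148 : ℤ) : ℚ)⟩ : WeierstrassCurve ℚ).FineSelmerDualData κ γ),
      Module.Finite ℤ_[2] (RestrictScalars ℤ_[2] (IwasawaAlgebra 2) D.X) := by
  haveI := (isElliptic_cubicModel _ _ _ (by simp only [Cubic.discr]; norm_num) : (⟨0, ((0 : ℤ) : ℚ), 0, ((-6755728 : ℤ) : ℚ), ((-6761091148 : ℤ) : ℚ)⟩ : WeierstrassCurve ℚ).IsElliptic)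
  have hθ' : θ ^ 3 + (-1 : AlgebraicClosure ℚ) * θ ^ 2 + (-9 : AlgebraicClosure ℚ) * θ + (-41 : AlgebraicClosure ℚ) = 0 := by
    have := hθ
    simp only [Cubic.toPoly, map_one, one_mul, aeval_add, aeval_mul, aeval_C, aeval_X_pow, aeval_X,
      eq_ratCast, Rat.cast_intCast] at this
    push_cast at this
    linear_combination this
  set β : AlgebraicClosure ℚ := algebraMap ℚ (AlgebraicClosure ℚ) (-693 : ℚ) +
      algebraMap ℚ (AlgebraicClosure ℚ) (350 : ℚ) * θ + algebraMap ℚ (AlgebraicClosure ℚ) (91 : ℚ) * θ ^ 2 with hβdef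
  have hβ : aeval β (Cubic.toPoly ⟨1, ((0 : ℤ) : ℚ), ((-6755728 : ℤ) : ℚ), ((-6761091148 : ℤ) : ℚ)⟩) = 0 := by
    simp only [Cubic.toPoly, map_one, one_mul, aeval_add, aeval_mul, aeval_C, aeval_X_pow, aeval_X, eq_ratCast,
      Rat.cast_intCast]
    rw [hβdef]
    simp only [eq_ratCast]
    push_cast
    linear_combination ((58833761 : AlgebraicClosure ℚ) + (32457061 : AlgebraicClosure ℚ) * θ + (9448621 : AlgebraicClosure ℚ) * θ ^ 2 + (753571 : AlgebraicClosure ℚ) * θ ^ 3) * hθ'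
  have hadj : IntermediateField.adjoin ℚ {β} = IntermediateField.adjoin ℚ {θ} := by
    apply le_antisymm
    · rw [IntermediateField.adjoin_simple_le_iff, hβdef]
      have hθmem := IntermediateField.mem_adjoin_simple_self ℚ θ
      exact add_mem (add_mem (algebraMap_mem _ _) (mul_mem (algebraMap_mem _ _) hθmem))
        (mul_mem (algebraMap_mem _ _) (pow_mem hθmem 2))
    · rw [IntermediateField.adjoin_simple_le_iff]
      have hθeq : θ = algebraMap ℚ (AlgebraicClosure ℚ) (599537 / 6275 : ℚ) +
          algebraMap ℚ (AlgebraicClosure ℚ) (1458 / 43925 : ℚ) * β +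
          algebraMap ℚ (AlgebraicClosure ℚ) (-13 / 614950 : ℚ) * β ^ 2 := by
        rw [hβdef]; simp only [eq_ratCast]; push_cast
        linear_combination (((19097 : AlgebraicClosure ℚ) / 12550) + ((2197 : AlgebraicClosure ℚ) / 12550) * θ) * hθ'
      rw [hθeq]
      have hβmem := IntermediateField.mem_adjoin_simple_self ℚ β
      exact add_mem (add_mem (algebraMap_mem _ _) (mul_mem (algebraMap_mem _ _) hβmem))
        (mul_mem (algebraMap_mem _ _) (pow_mem hβmem 2))
  haveI : FiniteDimensional ℚ (IntermediateField.adjoin ℚ {θ}) :=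
    IntermediateField.adjoin.finiteDimensional ((AlgebraicClosure.isAlgebraic ℚ).isAlgebraic θ).isIntegral
  haveI : NumberField (IntermediateField.adjoin ℚ {θ}) := NumberField.mk
  have h3 := finrank_adjoin_eq_three_of_irreducible irreducible_cubic_h245980i1 hθ
  have h3β : Module.finrank ℚ (IntermediateField.adjoin ℚ {β}) = 3 := by rw [hadj]; exact h3
  have hμ : ∀ κL : ZpExtension (IntermediateField.adjoin ℚ {θ}) 2, κL.IsCyclotomic → ClassicalMuVanishes κL :=
    fun κL hκL => classicalMuVanishes_of_classGroupPRank_succ_eq' κL (hcert κL hκL).1 (by norm_num) (hcert κL hκL).2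
  exact TotallyComplexMu.conjA_two_cubicModel_of_classicalMu_of_discr_neg (0) (-6755728) (-6761091148)
    (irreducibleCubic_of_finrank_three_tcA hβ h3β) (by simp only [Cubic.discr]; norm_num) hβ
    (by rw [hadj]; exact hμ) κ hκ

/-- `X³ + (-1)X² + (18)X + (-10)` (a reduced model of the `2`-torsion cubic field of `112520h1`, discriminant `-22504`) is irreducible over `ℚ`
(no root mod `7`). -/
theorem irreducible_cubic_h112520h1 : Irreducible (Cubic.toPoly ⟨1, ((-1 : ℤ) : ℚ), ((18 : ℤ) : ℚ), ((-10 : ℤ) : ℚ)⟩) :=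
  haveI : Fact (Nat.Prime 7) := ⟨by norm_num⟩
  irreducible_cubic_of_no_root_zmod 7 (by decide)

/-- **(A)₂ for `112520h1` WITHOUT any print fact — ONE displayed two-conjunct TOWER CERTIFICATE on the cubic point field** (open-type row of the
C1″ census: `d = −22504`, `2 = 𝔭²𝔮`, `Cl = [2]`; tower ranks 1 / 2 / 2 (`[2], [2,2], [4,2]`)). `θ` is any root of `X³ + (-1)X² + (18)X + (-10)` (`ℚ(P) = ℚ(β) = ℚ(θ)`, `β = x(P) = 6816 + (-252)θ + (577)θ²`
a root of the `2`-division cubic); displayed: along every cyclotomic `ℤ₂`-extension of `ℚ(θ)`, total ramification from layer `0` AND equal `2`-ranks of the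
class groups at layers `1`, `1 + 1` (instrument tier: PARI `bnfinit`, GRH at degree ≥ 12; cell TSV `addL2x/gen8/conjA3_census_j300990_classes.tsv`).
KERNEL: Fukuda 1994 Thm. 1 (2) (`classicalMuVanishes_of_classGroupPRank_succ_eq'`, tree `_holds`) ⟹ `μ₂(ℚ(θ)_cyc) = 0` ⟹ cruxlead-19573-w2's `ℓ = 2` ascent
to the totally complex `ℚ(E[2])` (`Δ_cubic < 0`) and guarded kernel Lim 3.5@2 (`TotallyComplexMu.conjA_two_cubicModel_of_classicalMu_of_discr_neg`, p728213).
No `hLim2`, no Fukuda fact, no class-number bit. BSD for `112520h1` is NOT proved by this. [cite: CoatesSujatha2005, Conj. A and Thm. 3.4]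
[cite: Fukuda1994, Thm. 1 (2), p. 264] [cite: Iwasawa1973MuInvariants, Thm. 2 and Thm. 3] [cite: Washington1997, §13.1 Lemma 13.3] -/
theorem conjA_two_112520h1_of_towerCert
    {θ : AlgebraicClosure ℚ} (hθ : aeval θ (Cubic.toPoly ⟨1, ((-1 : ℤ) : ℚ), ((18 : ℤ) : ℚ), ((-10 : ℤ) : ℚ)⟩) = 0)
    (hcert : haveI : FiniteDimensional ℚ (IntermediateField.adjoin ℚ {θ}) :=
        IntermediateField.adjoin.finiteDimensional ((AlgebraicClosure.isAlgebraic ℚ).isAlgebraic θ).isIntegral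
      haveI : NumberField (IntermediateField.adjoin ℚ {θ}) := NumberField.mk
      ∀ κL : ZpExtension (IntermediateField.adjoin ℚ {θ}) 2, κL.IsCyclotomic →
        TotallyRamifiedFrom κL 0 ∧ classGroupPRank κL (1 + 1) = classGroupPRank κL 1)
    (κ : ZpExtension ℚ 2) (hκ : κ.IsCyclotomic) :
    haveI := (isElliptic_cubicModel _ _ _ (by simp only [Cubic.discr]; norm_num) : (⟨0, ((-1 : ℤ) : ℚ), 0, ((-35261600 : ℤ) : ℚ), ((-80581954900 : ℤ) : ℚ)⟩ : WeierstrassCurve ℚ).IsElliptic)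
    ∃ (γ : absoluteGaloisGroup ℚ) (D : (⟨0, ((-1 : ℤ) : ℚ), 0, ((-35261600 : ℤ) : ℚ), ((-80581954900 : ℤ) : ℚ)⟩ : WeierstrassCurve ℚ).FineSelmerDualData κ γ),
      Module.Finite ℤ_[2] (RestrictScalars ℤ_[2] (IwasawaAlgebra 2) D.X) := by
  haveI := (isElliptic_cubicModel _ _ _ (by simp only [Cubic.discr]; norm_num) : (⟨0, ((-1 : ℤ) : ℚ), 0, ((-35261600 : ℤ) : ℚ), ((-80581954900 : ℤ) : ℚ)⟩ : WeierstrassCurve ℚ).IsElliptic)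
  have hθ' : θ ^ 3 + (-1 : AlgebraicClosure ℚ) * θ ^ 2 + (18 : AlgebraicClosure ℚ) * θ + (-10 : AlgebraicClosure ℚ) = 0 := by
    have := hθ
    simp only [Cubic.toPoly, map_one, one_mul, aeval_add, aeval_mul, aeval_C, aeval_X_pow, aeval_X,
      eq_ratCast, Rat.cast_intCast] at this
    push_cast at this
    linear_combination this
  set β : AlgebraicClosure ℚ := algebraMap ℚ (AlgebraicClosure ℚ) (6816 : ℚ) +
      algebraMap ℚ (AlgebraicClosure ℚ) (-252 : ℚ) * θ + algebraMap ℚ (AlgebraicClosure ℚ) (577 : ℚ) * θ ^ 2 with hβdef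
  have hβ : aeval β (Cubic.toPoly ⟨1, ((-1 : ℤ) : ℚ), ((-35261600 : ℤ) : ℚ), ((-80581954900 : ℤ) : ℚ)⟩) = 0 := by
    simp only [Cubic.toPoly, map_one, one_mul, aeval_add, aeval_mul, aeval_C, aeval_X_pow, aeval_X, eq_ratCast,
      Rat.cast_intCast]
    rw [hβdef]
    simp only [eq_ratCast]
    push_cast
    linear_combination ((431473186 : AlgebraicClosure ℚ) + (3399929802 : AlgebraicClosure ℚ) * θ + (-59594291 : AlgebraicClosure ℚ) * θ ^ 2 + (192100033 : AlgebraicClosure ℚ) * θ ^ 3) * hθ'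
  have hadj : IntermediateField.adjoin ℚ {β} = IntermediateField.adjoin ℚ {θ} := by
    apply le_antisymm
    · rw [IntermediateField.adjoin_simple_le_iff, hβdef]
      have hθmem := IntermediateField.mem_adjoin_simple_self ℚ θ
      exact add_mem (add_mem (algebraMap_mem _ _) (mul_mem (algebraMap_mem _ _) hθmem))
        (mul_mem (algebraMap_mem _ _) (pow_mem hθmem 2))
    · rw [IntermediateField.adjoin_simple_le_iff]
      have hθeq : θ = algebraMap ℚ (AlgebraicClosure ℚ) (46770029 / 58 : ℚ) +
          algebraMap ℚ (AlgebraicClosure ℚ) (1978567 / 16820 : ℚ) * β +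
          algebraMap ℚ (AlgebraicClosure ℚ) (-577 / 16820 : ℚ) * β ^ 2 := by
        rw [hβdef]; simp only [eq_ratCast]; push_cast
        linear_combination (((24303817 : AlgebraicClosure ℚ) / 16820) + ((192100033 : AlgebraicClosure ℚ) / 16820) * θ) * hθ'
      rw [hθeq]
      have hβmem := IntermediateField.mem_adjoin_simple_self ℚ β
      exact add_mem (add_mem (algebraMap_mem _ _) (mul_mem (algebraMap_mem _ _) hβmem))
        (mul_mem (algebraMap_mem _ _) (pow_mem hβmem 2))
  haveI : FiniteDimensional ℚ (IntermediateField.adjoin ℚ {θ}) :=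
    IntermediateField.adjoin.finiteDimensional ((AlgebraicClosure.isAlgebraic ℚ).isAlgebraic θ).isIntegral
  haveI : NumberField (IntermediateField.adjoin ℚ {θ}) := NumberField.mk
  have h3 := finrank_adjoin_eq_three_of_irreducible irreducible_cubic_h112520h1 hθ
  have h3β : Module.finrank ℚ (IntermediateField.adjoin ℚ {β}) = 3 := by rw [hadj]; exact h3
  have hμ : ∀ κL : ZpExtension (IntermediateField.adjoin ℚ {θ}) 2, κL.IsCyclotomic → ClassicalMuVanishes κL :=
    fun κL hκL => classicalMuVanishes_of_classGroupPRank_succ_eq' κL (hcert κL hκL).1 (by norm_num) (hcert κL hκL).2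
  exact TotallyComplexMu.conjA_two_cubicModel_of_classicalMu_of_discr_neg (-1) (-35261600) (-80581954900)
    (irreducibleCubic_of_finrank_three_tcA hβ h3β) (by simp only [Cubic.discr]; norm_num) hβ
    (by rw [hadj]; exact hμ) κ hκ

end Summit.BirchSwinnertonDyer.BirchSwinnertonDyer.Theorems.AddKatoTwo

/-! ## §2 The C3″ rungs (namespace `AddPotGoodInstances`) -/

namespace Summit.BirchSwinnertonDyer.BirchSwinnertonDyer.Theorems.AddPotGoodInstances

open WeierstrassCurve Polynomial Literature.NumberTheory.EllipticCurves
  Literature.NumberTheory.IwasawaTheory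
  Literature.NumberTheory.EllipticCurves.Rank1Residual
  Literature.NumberTheory.EllipticCurves.Rank1Residual.Typed
  Summit.BirchSwinnertonDyer.Rank1Residual
  Summit.BirchSwinnertonDyer.Rank1Residual.Additive
  Summit.BirchSwinnertonDyer.BirchSwinnertonDyer.Theorems

/-- Model transport for (A) at `2` in the `∃ γ D` spelling (the statement only depends on the Weierstrass CURVE).
[cite: CoatesSujatha2005, statement (A)] -/
private theorem conjA_two_of_eq {W W' : WeierstrassCurve ℚ} (h : W' = W)
    (H : ∀ (κ : ZpExtension ℚ 2), κ.IsCyclotomic →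
      ∃ (γ : Field.absoluteGaloisGroup ℚ) (D : W'.FineSelmerDualData κ γ), Module.Finite ℤ_[2] (RestrictScalars ℤ_[2] (IwasawaAlgebra 2) D.X)) :
    ∀ (κ : ZpExtension ℚ 2), κ.IsCyclotomic →
      ∃ (γ : Field.absoluteGaloisGroup ℚ) (D : W.FineSelmerDualData κ γ), Module.Finite ℤ_[2] (RestrictScalars ℤ_[2] (IwasawaAlgebra 2) D.X) := by
  subst h; exact H

/-! ## Row `245980i1` (Δ_cubic < 0, open type; stamp `AddKatoTwo.conjA_two_245980i1_of_towerCert` of §1) -/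

/-- **(A) at `(245980i1, 2)` for the Cremona model from ONE displayed tower certificate, NO print fact**: §1's `AddKatoTwo.conjA_two_245980i1_of_towerCert`
transported from its cast model `⟨0, ((0 : ℤ) : ℚ), 0, ((-6755728 : ℤ) : ℚ), ((-6761091148 : ℤ) : ℚ)⟩` to the literal model. [cite: CoatesSujatha2005, statement (A)] [cite: Fukuda1994, Thm. 1 (2), p. 264] -/
theorem conjA_two_245980i1_of_towerCert_kernelLit
    {θ : AlgebraicClosure ℚ} (hθ : aeval θ (Cubic.toPoly ⟨1, ((-1 : ℤ) : ℚ), ((-9 : ℤ) : ℚ), ((-41 : ℤ) : ℚ)⟩) = 0)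
    (hcert : haveI : FiniteDimensional ℚ (IntermediateField.adjoin ℚ {θ}) :=
        IntermediateField.adjoin.finiteDimensional ((AlgebraicClosure.isAlgebraic ℚ).isAlgebraic θ).isIntegral
      haveI : NumberField (IntermediateField.adjoin ℚ {θ}) := NumberField.mk
      ∀ κL : ZpExtension (IntermediateField.adjoin ℚ {θ}) 2, κL.IsCyclotomic →
        TotallyRamifiedFrom κL 0 ∧ classGroupPRank κL (1 + 1) = classGroupPRank κL 1)
    :
    haveI := isElliptic_245980i1
    ∀ (κ : ZpExtension ℚ 2), κ.IsCyclotomic →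
      ∃ (γ : Field.absoluteGaloisGroup ℚ) (D : (⟨0, 0, 0, -6755728, -6761091148⟩ : WeierstrassCurve ℚ).FineSelmerDualData κ γ),
        Module.Finite ℤ_[2] (RestrictScalars ℤ_[2] (IwasawaAlgebra 2) D.X) :=
  conjA_two_of_eq (W' := (⟨0, ((0 : ℤ) : ℚ), 0, ((-6755728 : ℤ) : ℚ), ((-6761091148 : ℤ) : ℚ)⟩ : WeierstrassCurve ℚ)) (by norm_num) (fun κ hκ ↦ AddKatoTwo.conjA_two_245980i1_of_towerCert hθ hcert κ hκ)

/-- **`BSD₂(245980i1)` with (A) from ONE displayed tower certificate and NO print fact for (A)**: GEN 3's rung `bsdp_two_245980i1_of_conjA` with `hA` supplied by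
`conjA_two_245980i1_of_towerCert_kernelLit hθ hcert`. Conditional on PRINT {`hSharp` (reading), `hGZK`, `hmod`, `hCT`}, the RECORD `hr`, `#Ш_an = q` (`ord₂ q ≤ 6`),
the two VALUED slots and the instrument certificate `hcert` — compared with GEN 3's `…_of_fukudaCertificate_pointField` rung the binders `hLim2`, `hFuk` are GONE
and the certificate lives on the CUBIC tower (degrees `3·2ⁿ`) instead of `ℚ(P, i)`. Nothing booked; BSD is not proved by this.
[cite: Kato2004Asterisque, Thm. 12.5 (1)(3), 13.8, 14.14] [cite: Fukuda1994, Thm. 1 (2)] [cite: Miller2011LMS, Def. 1.1] -/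
theorem bsdp_two_245980i1_towerCert
    (hSharp : Kato2004.rankZero_padicValNat_sha_add_padicValNat_tamagawa_le_at_two_of_irreducible_of_fineSelmerDual_fg)
    (hGZK : rank_eq_analyticRank_of_analyticRank_le_one) (hmod : hasEntireLFunction_rat)
    (hCT : exists_casselsTate_pairing (K := ℚ))
    {θ : AlgebraicClosure ℚ} (hθ : aeval θ (Cubic.toPoly ⟨1, ((-1 : ℤ) : ℚ), ((-9 : ℤ) : ℚ), ((-41 : ℤ) : ℚ)⟩) = 0)
    (hcert : haveI : FiniteDimensional ℚ (IntermediateField.adjoin ℚ {θ}) :=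
        IntermediateField.adjoin.finiteDimensional ((AlgebraicClosure.isAlgebraic ℚ).isAlgebraic θ).isIntegral
      haveI : NumberField (IntermediateField.adjoin ℚ {θ}) := NumberField.mk
      ∀ κL : ZpExtension (IntermediateField.adjoin ℚ {θ}) 2, κL.IsCyclotomic →
        TotallyRamifiedFrom κL 0 ∧ classGroupPRank κL (1 + 1) = classGroupPRank κL 1)
    (hr : haveI := isElliptic_245980i1; (⟨0, 0, 0, -6755728, -6761091148⟩ : WeierstrassCurve ℚ).analyticRank = 0)
    (hs₁ : Nat.card ((⟨0, 0, 0, -6755728, -6761091148⟩ : WeierstrassCurve ℚ).selmerGroup (2 ^ 2)) = 2 ^ 4)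
    (hs₂ : Nat.card ((⟨0, 0, 0, -6755728, -6761091148⟩ : WeierstrassCurve ℚ).selmerGroup (2 ^ (2 + 1))) = 2 ^ 6)
    {q : ℚ} (hq : haveI := isElliptic_245980i1; shaAn (⟨0, 0, 0, -6755728, -6761091148⟩ : WeierstrassCurve ℚ) = (q : ℂ)) (hv : padicValRat 2 q ≤ 6) :
    haveI := isElliptic_245980i1; haveI := isGloballyMinimal_245980i1
    BSDp (⟨0, 0, 0, -6755728, -6761091148⟩ : WeierstrassCurve ℚ) 2 := by
  exact bsdp_two_245980i1_of_conjA hSharp hGZK hmod hCT (conjA_two_245980i1_of_towerCert_kernelLit hθ hcert) hr hs₁ hs₂ hq hv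

/-- **`BSD₂` ON THE WHOLE CLASS of `245980i1` with (A) from ONE displayed tower certificate and NO print fact for (A)**: GEN 3's class rung
`bsdp_two_of_isIsogenous_245980i1_of_conjA` (Cassels transport `hCassels`) with `hA` from `conjA_two_245980i1_of_towerCert_kernelLit hθ hcert`.
Nothing booked; BSD is not proved by this. [cite: Cassels1965ArithmeticVIII, Thm. 1.3] [cite: Kato2004Asterisque, Thm. 12.5 (1)(3)] [cite: Fukuda1994, Thm. 1 (2)] -/
theorem bsdp_two_of_isIsogenous_245980i1_towerCert
    (hSharp : Kato2004.rankZero_padicValNat_sha_add_padicValNat_tamagawa_le_at_two_of_irreducible_of_fineSelmerDual_fg)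
    (hGZK : rank_eq_analyticRank_of_analyticRank_le_one) (hmod : hasEntireLFunction_rat)
    (hCT : exists_casselsTate_pairing (K := ℚ)) (hCassels : bsdRHS_eq_of_isIsogenous)
    {θ : AlgebraicClosure ℚ} (hθ : aeval θ (Cubic.toPoly ⟨1, ((-1 : ℤ) : ℚ), ((-9 : ℤ) : ℚ), ((-41 : ℤ) : ℚ)⟩) = 0)
    (hcert : haveI : FiniteDimensional ℚ (IntermediateField.adjoin ℚ {θ}) :=
        IntermediateField.adjoin.finiteDimensional ((AlgebraicClosure.isAlgebraic ℚ).isAlgebraic θ).isIntegral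
      haveI : NumberField (IntermediateField.adjoin ℚ {θ}) := NumberField.mk
      ∀ κL : ZpExtension (IntermediateField.adjoin ℚ {θ}) 2, κL.IsCyclotomic →
        TotallyRamifiedFrom κL 0 ∧ classGroupPRank κL (1 + 1) = classGroupPRank κL 1)
    {W : WeierstrassCurve ℚ} [W.IsElliptic] [W.IsGloballyMinimal]
    (hiso : haveI := isElliptic_245980i1; IsIsogenous W (⟨0, 0, 0, -6755728, -6761091148⟩ : WeierstrassCurve ℚ)) (hr : W.analyticRank = 0)
    (hs₁ : Nat.card ((⟨0, 0, 0, -6755728, -6761091148⟩ : WeierstrassCurve ℚ).selmerGroup (2 ^ 2)) = 2 ^ 4)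
    (hs₂ : Nat.card ((⟨0, 0, 0, -6755728, -6761091148⟩ : WeierstrassCurve ℚ).selmerGroup (2 ^ (2 + 1))) = 2 ^ 6)
    {q : ℚ} (hq : haveI := isElliptic_245980i1; shaAn (⟨0, 0, 0, -6755728, -6761091148⟩ : WeierstrassCurve ℚ) = (q : ℂ)) (hv : padicValRat 2 q ≤ 6) :
    BSDp W 2 := by
  exact bsdp_two_of_isIsogenous_245980i1_of_conjA hSharp hGZK hmod hCT hCassels (conjA_two_245980i1_of_towerCert_kernelLit hθ hcert) hiso hr hs₁ hs₂ hq hv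

/-! ## Row `112520h1` (Δ_cubic < 0, open type; stamp `AddKatoTwo.conjA_two_112520h1_of_towerCert` of §1) -/

/-- **(A) at `(112520h1, 2)` for the Cremona model from ONE displayed tower certificate, NO print fact**: §1's `AddKatoTwo.conjA_two_112520h1_of_towerCert`
transported from its cast model `⟨0, ((-1 : ℤ) : ℚ), 0, ((-35261600 : ℤ) : ℚ), ((-80581954900 : ℤ) : ℚ)⟩` to the literal model. [cite: CoatesSujatha2005, statement (A)] [cite: Fukuda1994, Thm. 1 (2), p. 264] -/
theorem conjA_two_112520h1_of_towerCert_kernelLit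
    {θ : AlgebraicClosure ℚ} (hθ : aeval θ (Cubic.toPoly ⟨1, ((-1 : ℤ) : ℚ), ((18 : ℤ) : ℚ), ((-10 : ℤ) : ℚ)⟩) = 0)
    (hcert : haveI : FiniteDimensional ℚ (IntermediateField.adjoin ℚ {θ}) :=
        IntermediateField.adjoin.finiteDimensional ((AlgebraicClosure.isAlgebraic ℚ).isAlgebraic θ).isIntegral
      haveI : NumberField (IntermediateField.adjoin ℚ {θ}) := NumberField.mk
      ∀ κL : ZpExtension (IntermediateField.adjoin ℚ {θ}) 2, κL.IsCyclotomic →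
        TotallyRamifiedFrom κL 0 ∧ classGroupPRank κL (1 + 1) = classGroupPRank κL 1)
    :
    haveI := isElliptic_112520h1
    ∀ (κ : ZpExtension ℚ 2), κ.IsCyclotomic →
      ∃ (γ : Field.absoluteGaloisGroup ℚ) (D : (⟨0, -1, 0, -35261600, -80581954900⟩ : WeierstrassCurve ℚ).FineSelmerDualData κ γ),
        Module.Finite ℤ_[2] (RestrictScalars ℤ_[2] (IwasawaAlgebra 2) D.X) :=
  conjA_two_of_eq (W' := (⟨0, ((-1 : ℤ) : ℚ), 0, ((-35261600 : ℤ) : ℚ), ((-80581954900 : ℤ) : ℚ)⟩ : WeierstrassCurve ℚ)) (by norm_num) (fun κ hκ ↦ AddKatoTwo.conjA_two_112520h1_of_towerCert hθ hcert κ hκ)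

/-- **`BSD₂(112520h1)` with (A) from ONE displayed tower certificate and NO print fact for (A)**: GEN 3's rung `bsdp_two_112520h1_of_conjA` with `hA` supplied by
`conjA_two_112520h1_of_towerCert_kernelLit hθ hcert`. Conditional on PRINT {`hSharp` (reading), `hGZK`, `hmod`, `hCT`}, the RECORD `hr`, `#Ш_an = q` (`ord₂ q ≤ 6`),
the two VALUED slots and the instrument certificate `hcert` — compared with GEN 3's `…_of_fukudaCertificate_pointField` rung the binders `hLim2`, `hFuk` are GONE
and the certificate lives on the CUBIC tower (degrees `3·2ⁿ`) instead of `ℚ(P, i)`. Nothing booked; BSD is not proved by this.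
[cite: Kato2004Asterisque, Thm. 12.5 (1)(3), 13.8, 14.14] [cite: Fukuda1994, Thm. 1 (2)] [cite: Miller2011LMS, Def. 1.1] -/
theorem bsdp_two_112520h1_towerCert
    (hSharp : Kato2004.rankZero_padicValNat_sha_add_padicValNat_tamagawa_le_at_two_of_irreducible_of_fineSelmerDual_fg)
    (hGZK : rank_eq_analyticRank_of_analyticRank_le_one) (hmod : hasEntireLFunction_rat)
    (hCT : exists_casselsTate_pairing (K := ℚ))
    {θ : AlgebraicClosure ℚ} (hθ : aeval θ (Cubic.toPoly ⟨1, ((-1 : ℤ) : ℚ), ((18 : ℤ) : ℚ), ((-10 : ℤ) : ℚ)⟩) = 0)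
    (hcert : haveI : FiniteDimensional ℚ (IntermediateField.adjoin ℚ {θ}) :=
        IntermediateField.adjoin.finiteDimensional ((AlgebraicClosure.isAlgebraic ℚ).isAlgebraic θ).isIntegral
      haveI : NumberField (IntermediateField.adjoin ℚ {θ}) := NumberField.mk
      ∀ κL : ZpExtension (IntermediateField.adjoin ℚ {θ}) 2, κL.IsCyclotomic →
        TotallyRamifiedFrom κL 0 ∧ classGroupPRank κL (1 + 1) = classGroupPRank κL 1)
    (hr : haveI := isElliptic_112520h1; (⟨0, -1, 0, -35261600, -80581954900⟩ : WeierstrassCurve ℚ).analyticRank = 0)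
    (hs₁ : Nat.card ((⟨0, -1, 0, -35261600, -80581954900⟩ : WeierstrassCurve ℚ).selmerGroup (2 ^ 2)) = 2 ^ 4)
    (hs₂ : Nat.card ((⟨0, -1, 0, -35261600, -80581954900⟩ : WeierstrassCurve ℚ).selmerGroup (2 ^ (2 + 1))) = 2 ^ 6)
    {q : ℚ} (hq : haveI := isElliptic_112520h1; shaAn (⟨0, -1, 0, -35261600, -80581954900⟩ : WeierstrassCurve ℚ) = (q : ℂ)) (hv : padicValRat 2 q ≤ 6) :
    haveI := isElliptic_112520h1; haveI := isGloballyMinimal_112520h1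
    BSDp (⟨0, -1, 0, -35261600, -80581954900⟩ : WeierstrassCurve ℚ) 2 := by
  exact bsdp_two_112520h1_of_conjA hSharp hGZK hmod hCT (conjA_two_112520h1_of_towerCert_kernelLit hθ hcert) hr hs₁ hs₂ hq hv

/-- **`BSD₂` ON THE WHOLE CLASS of `112520h1` with (A) from ONE displayed tower certificate and NO print fact for (A)**: GEN 3's class rung
`bsdp_two_of_isIsogenous_112520h1_of_conjA` (Cassels transport `hCassels`) with `hA` from `conjA_two_112520h1_of_towerCert_kernelLit hθ hcert`.
Nothing booked; BSD is not proved by this. [cite: Cassels1965ArithmeticVIII, Thm. 1.3] [cite: Kato2004Asterisque, Thm. 12.5 (1)(3)] [cite: Fukuda1994, Thm. 1 (2)] -/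
theorem bsdp_two_of_isIsogenous_112520h1_towerCert
    (hSharp : Kato2004.rankZero_padicValNat_sha_add_padicValNat_tamagawa_le_at_two_of_irreducible_of_fineSelmerDual_fg)
    (hGZK : rank_eq_analyticRank_of_analyticRank_le_one) (hmod : hasEntireLFunction_rat)
    (hCT : exists_casselsTate_pairing (K := ℚ)) (hCassels : bsdRHS_eq_of_isIsogenous)
    {θ : AlgebraicClosure ℚ} (hθ : aeval θ (Cubic.toPoly ⟨1, ((-1 : ℤ) : ℚ), ((18 : ℤ) : ℚ), ((-10 : ℤ) : ℚ)⟩) = 0)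
    (hcert : haveI : FiniteDimensional ℚ (IntermediateField.adjoin ℚ {θ}) :=
        IntermediateField.adjoin.finiteDimensional ((AlgebraicClosure.isAlgebraic ℚ).isAlgebraic θ).isIntegral
      haveI : NumberField (IntermediateField.adjoin ℚ {θ}) := NumberField.mk
      ∀ κL : ZpExtension (IntermediateField.adjoin ℚ {θ}) 2, κL.IsCyclotomic →
        TotallyRamifiedFrom κL 0 ∧ classGroupPRank κL (1 + 1) = classGroupPRank κL 1)
    {W : WeierstrassCurve ℚ} [W.IsElliptic] [W.IsGloballyMinimal]
    (hiso : haveI := isElliptic_112520h1; IsIsogenous W (⟨0, -1, 0, -35261600, -80581954900⟩ : WeierstrassCurve ℚ)) (hr : W.analyticRank = 0)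
    (hs₁ : Nat.card ((⟨0, -1, 0, -35261600, -80581954900⟩ : WeierstrassCurve ℚ).selmerGroup (2 ^ 2)) = 2 ^ 4)
    (hs₂ : Nat.card ((⟨0, -1, 0, -35261600, -80581954900⟩ : WeierstrassCurve ℚ).selmerGroup (2 ^ (2 + 1))) = 2 ^ 6)
    {q : ℚ} (hq : haveI := isElliptic_112520h1; shaAn (⟨0, -1, 0, -35261600, -80581954900⟩ : WeierstrassCurve ℚ) = (q : ℂ)) (hv : padicValRat 2 q ≤ 6) :
    BSDp W 2 := by
  exact bsdp_two_of_isIsogenous_112520h1_of_conjA hSharp hGZK hmod hCT hCassels (conjA_two_112520h1_of_towerCert_kernelLit hθ hcert) hiso hr hs₁ hs₂ hq hv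

end Summit.BirchSwinnertonDyer.BirchSwinnertonDyer.Theorems.AddPotGoodInstances

end
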